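import Literature.Probability.Distributions.FiniteProductLaws
import HarnessLib

/-!
# The law of finitely many independent, not identically distributed, discrete variables

Topic `Probability/Distributions`; companion of `FiniteProductLaws.lean` (`prodLaw` for pairs,
`piLaw` for finite families of laws on FINITE types). This file adds the product law of `K`
independent variables `X₀, …, X_{K-1}` with arbitrary laws `p j : PMF α` on an arbitrary type
(e.g. bit strings), as a `PMF (Fin K → α)` defined by recursion on `K` (`Fin.cons` of a fresh sample
of law `p 0` onto the product of the remaining `K` laws), in the style of the iid product
`LWE.iidPMF` of `Computability/Cryptography/LWE.lean` (which is the case of a constant family):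

* `indepLaw K p` and its unfolding equations;
* `indepLaw_apply` — **the product formula** `(⨂ⱼ p j)(v) = ∏ⱼ p j (v j)` (independence);
* `indepLaw_eq_of_apply` — a `PMF` on `Fin K → α` with these point masses IS the product law.

Consumer: the output law of the indexed parallel-copies family (`PolyCopiesIdxLaw.lean`: the measured
block contents are independent with block-dependent laws).

## References

* W. Feller, *An Introduction to Probability Theory and Its Applications I*, 3rd ed., Wiley 1968,
  Ch. IX §1 (independent trials with variable distributions; product probabilities) [folklore].
-/

noncomputable section

namespace Literature.Probability.Distributions

open scoped ENNReal

variable {α : Type*}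

/-- **The law of `K` independent variables with laws `p 0, …, p (K-1)`**, as a `PMF` on
`Fin K → α`: draw `a ← p 0`, then independently the remaining tuple, and prepend. [folklore] -/
def indepLaw : (K : ℕ) → (Fin K → PMF α) → PMF (Fin K → α)
  | 0, _ => PMF.pure Fin.elim0
  | K + 1, p => (p 0).bind fun a => (indepLaw K fun j => p j.succ).map fun v => Fin.cons a v

/-- `indepLaw 0` is the Dirac mass at the empty tuple. [folklore] -/
@[simp] theorem indepLaw_zero (p : Fin 0 → PMF α) : indepLaw 0 p = PMF.pure Fin.elim0 := rfl

/-- Unfolding equation for `indepLaw (K + 1)`. [folklore] -/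
theorem indepLaw_succ (K : ℕ) (p : Fin (K + 1) → PMF α) :
    indepLaw (K + 1) p = (p 0).bind fun a => (indepLaw K fun j => p j.succ).map fun v => Fin.cons a v := rfl

/-- **Product formula**: the tuple `v` has mass `∏ⱼ p j (v j)` under `indepLaw K p` (independence).
By induction on `K`: in the `bind`/`map` unfolding only `a = v 0`, `w = Fin.tail v` contributes.
[folklore] -/
theorem indepLaw_apply : ∀ (K : ℕ) (p : Fin K → PMF α) (v : Fin K → α), indepLaw K p v = ∏ j, p j (v j)
  | 0, p, v => by
    rw [indepLaw_zero, PMF.pure_apply, Fin.prod_univ_zero, if_pos (Subsingleton.elim _ _)]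
  | K + 1, p, v => by
    rw [indepLaw_succ, PMF.bind_apply, Fin.prod_univ_succ, tsum_eq_single (v 0)]
    · rw [PMF.map_apply, tsum_eq_single (Fin.tail v)]
      · rw [if_pos (Fin.cons_self_tail v).symm, indepLaw_apply K]
        rfl
      · intro w hw
        rw [if_neg]
        intro h
        exact hw (by rw [h, Fin.tail_cons])
    · intro x hx
      rw [PMF.map_apply, ENNReal.tsum_eq_zero.mpr, mul_zero]
      intro w
      rw [if_neg]
      intro h
      exact hx (by rw [h, Fin.cons_zero])

/-- **A law on tuples with the product point masses is the product law.** [folklore] -/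
theorem indepLaw_eq_of_apply {K : ℕ} (p : Fin K → PMF α) (q : PMF (Fin K → α))
    (h : ∀ v, q v = ∏ j, p j (v j)) : q = indepLaw K p :=
  PMF.ext fun v => by rw [h, indepLaw_apply]

/-- **The mass of a product event is the product of the masses** (independence of the coordinates):
`Pr[∀ j, vⱼ ∈ A j] = ∏ⱼ p j (A j)`. [folklore] -/
theorem toOuterMeasure_indepLaw_pi :
    ∀ (K : ℕ) (p : Fin K → PMF α) (A : Fin K → Set α),
      (indepLaw K p).toOuterMeasure {v | ∀ j, v j ∈ A j} = ∏ j, (p j).toOuterMeasure (A j)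
  | 0, p, A => by
    rw [Fin.prod_univ_zero, indepLaw_zero, PMF.toOuterMeasure_pure_apply, if_pos]
    exact fun j => j.elim0
  | K + 1, p, A => by
    classical
    rw [indepLaw_succ, PMF.toOuterMeasure_bind_apply, Fin.prod_univ_succ,
      ← toOuterMeasure_indepLaw_pi K (fun j => p j.succ) (fun j => A j.succ)]
    conv_rhs => rw [PMF.toOuterMeasure_apply (p 0) (A 0), ← ENNReal.tsum_mul_right]
    refine tsum_congr fun x => ?_
    rw [PMF.toOuterMeasure_map_apply]
    by_cases hx : x ∈ A 0
    · rw [Set.indicator_of_mem hx]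
      congr 2
      ext w
      simp only [Set.mem_preimage, Set.mem_setOf_eq, Fin.forall_fin_succ, Fin.cons_zero, Fin.cons_succ]
      exact ⟨fun h => h.2, fun h => ⟨hx, h⟩⟩
    · rw [Set.indicator_of_notMem hx, zero_mul]
      convert mul_zero (p 0 x)
      rw [← MeasureTheory.measure_empty (μ := (indepLaw K fun j => p j.succ).toOuterMeasure)]
      congr 1
      ext w
      simp only [Set.mem_preimage, Set.mem_setOf_eq, Set.mem_empty_iff_false, iff_false, not_forall]
      exact ⟨0, by simpa using hx⟩

end Literature.Probability.Distributions

end
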